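import Mathlib
import Summits.Ventures.PercRepro2.CoinChainAWorldGenLemmas

/-!
# The A-world decomposition for the GENERAL AND-switch chain — the theorems
(blind cell PercRepro2, night-2 g19; proofs/NIGHT2-DARC.md §59.18)

Exactly as for the pure chain (`CoinChainAWorld.lean`, `CoinChainAWorldCov.lean`):
`chainMix ent ent' ρ c d = (1 − θ)(c − d) + d`,
`chainMix ent ent' ρ c d' = (1 − θ)(c − d) + chainMix ent ent' ρ d d'`, and (★) at mixing
parameter `1/2` has three terms nonnegative for every head — the Ā-pair
(`abar_pair_nonneg_gen`), the Ā-gate centred at the A-means (FKG + `aw_cross_AG_gen`), the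
shift product (`aw_cross_AR_gen`) — and the fourth is the A-law's marker covariance:
`chain_functional_nonneg_of_covA` (numeric hypothesis `hD`),
`chain_functional_nonneg_of_diffLsm` (`c − d` log-supermodular ⟹ `hD` by FKG).
-/

namespace Summit.Ventures.PercRepro2.Coin

section ChainAWorldGen

variable {V : Type*} [DecidableEq V] {R : Type*} [Field R] [LinearOrder R] [IsStrictOrderedRing R]

/-- **THE GENERAL AND-SWITCH CHAIN WITH A NONNEGATIVE A-LAW COVARIANCE** (`a` entered from
`ent ⊆ U` surely and from `a'` by the coin): the A-world theorem for the general chain, with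
the numeric hypothesis `hD` (the two markers have nonnegative covariance under the A-law
`ν · (1 − θ) · (c − d)`, `θ = chainTheta ent ent' ρ`). -/
theorem chain_functional_nonneg_of_covA (U ent ent' : Finset V) (ν c d d' : Finset V → R)
    (ρ : R) (hρ0 : 0 ≤ ρ) (hρ1 : ρ ≤ 1) (hν0 : ∀ W, 0 ≤ ν W)
    (hν : ∀ s ⊆ U, ∀ t ⊆ U, ν s * ν t ≤ ν (s ∩ t) * ν (s ∪ t))
    (hc0 : ∀ W, 0 ≤ c W) (hd0 : ∀ W, 0 ≤ d W) (hd'0 : ∀ W, 0 ≤ d' W)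
    (hdc : ∀ W, d W ≤ c W) (hd'd : ∀ W, d' W ≤ d W)
    (hcc : ∀ s t, c s * c t ≤ c (s ∩ t) * c (s ∪ t))
    (hdd : ∀ s t, d s * d t ≤ d (s ∩ t) * d (s ∪ t))
    (hd'd' : ∀ s t, d' s * d' t ≤ d' (s ∩ t) * d' (s ∪ t))
    (hdd' : ∀ s t, d s * d' t ≤ d (s ∩ t) * d' (s ∪ t))
    (hratio : ∀ s t, s ⊆ t → d s * c t ≤ c s * d t)
    (hratio' : ∀ s t, s ⊆ t → d' s * c t ≤ c s * d' t)
    (hratio'' : ∀ s t, s ⊆ t → d' s * d t ≤ d s * d' t) (m₁ m₂ : V)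
    (hD : (∑ W ∈ U.powerset, ν W * ((1 - chainTheta ent ent' ρ W) * (c W - d W)) *
            (if m₁ ∈ W then (1 : R) else 0)) *
          (∑ W ∈ U.powerset, ν W * ((1 - chainTheta ent ent' ρ W) * (c W - d W)) *
            (if m₂ ∈ W then (1 : R) else 0)) ≤
        (∑ W ∈ U.powerset, ν W * ((1 - chainTheta ent ent' ρ W) * (c W - d W))) *
          (∑ W ∈ U.powerset, ν W * ((1 - chainTheta ent ent' ρ W) * (c W - d W)) *
            ((if m₁ ∈ W then (1 : R) else 0) * (if m₂ ∈ W then (1 : R) else 0)))) :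
    0 ≤ (∑ W ∈ U.powerset, ν W * chainMix ent ent' ρ c d W) ^ 2 *
          (∑ W ∈ U.powerset, ν W * chainMix ent ent' ρ c d' W *
            ((if m₁ ∈ W then (1 : R) else 0) * (if m₂ ∈ W then (1 : R) else 0)))
        - (∑ W ∈ U.powerset, ν W * chainMix ent ent' ρ c d W) *
          (∑ W ∈ U.powerset, ν W * chainMix ent ent' ρ c d W * (if m₁ ∈ W then (1 : R) else 0)) *
          (∑ W ∈ U.powerset, ν W * chainMix ent ent' ρ c d' W * (if m₂ ∈ W then (1 : R) else 0))
        - (∑ W ∈ U.powerset, ν W * chainMix ent ent' ρ c d W) *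
          (∑ W ∈ U.powerset, ν W * chainMix ent ent' ρ c d W * (if m₂ ∈ W then (1 : R) else 0)) *
          (∑ W ∈ U.powerset, ν W * chainMix ent ent' ρ c d' W * (if m₁ ∈ W then (1 : R) else 0))
        + (∑ W ∈ U.powerset, ν W * chainMix ent ent' ρ c d W * (if m₁ ∈ W then (1 : R) else 0)) *
          (∑ W ∈ U.powerset, ν W * chainMix ent ent' ρ c d W * (if m₂ ∈ W then (1 : R) else 0)) *
          (∑ W ∈ U.powerset, ν W * chainMix ent ent' ρ c d' W) := by
  -- the markers
  have hx0 : ∀ W : Finset V, (0 : R) ≤ (if m₁ ∈ W then (1 : R) else 0) := by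
    intro W; split_ifs <;> norm_num
  have hy0 : ∀ W : Finset V, (0 : R) ≤ (if m₂ ∈ W then (1 : R) else 0) := by
    intro W; split_ifs <;> norm_num
  have hx1 : ∀ W : Finset V, (if m₁ ∈ W then (1 : R) else 0) ≤ 1 := by
    intro W; split_ifs <;> norm_num
  have hy1 : ∀ W : Finset V, (if m₂ ∈ W then (1 : R) else 0) ≤ 1 := by
    intro W; split_ifs <;> norm_num
  have hxm : ∀ s t : Finset V,
      (if m₁ ∈ s then (1 : R) else 0) ≤ (if m₁ ∈ s ∪ t then (1 : R) else 0) := by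
    intro s t
    by_cases h : m₁ ∈ s
    · rw [if_pos h, if_pos (Finset.mem_union_left t h)]
    · rw [if_neg h]; split_ifs <;> norm_num
  have hym : ∀ s t : Finset V,
      (if m₂ ∈ s then (1 : R) else 0) ≤ (if m₂ ∈ s ∪ t then (1 : R) else 0) := by
    intro s t
    by_cases h : m₂ ∈ s
    · rw [if_pos h, if_pos (Finset.mem_union_left t h)]
    · rw [if_neg h]; split_ifs <;> norm_num
  -- the three laws of the decomposition (opaque, with pointwise equations)
  obtain ⟨hθ0, -, -⟩ := one_sub_theta_facts_gen ent ent' ρ hρ0 hρ1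
  obtain ⟨RA, hRA⟩ : ∃ RA : Finset V → R,
      ∀ W, RA W = ν W * ((1 - chainTheta ent ent' ρ W) * (c W - d W)) := ⟨_, fun _ => rfl⟩
  obtain ⟨RB, hRB⟩ : ∃ RB : Finset V → R, ∀ W, RB W = ν W * d W := ⟨_, fun _ => rfl⟩
  obtain ⟨GB, hGB⟩ : ∃ GB : Finset V → R, ∀ W, GB W = ν W * chainMix ent ent' ρ d d' W :=
    ⟨_, fun _ => rfl⟩
  have hcd0 : ∀ W, 0 ≤ c W - d W := fun W => by linarith [hdc W]
  have hRA0 : ∀ W, 0 ≤ RA W := fun W => by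
    rw [hRA]; exact mul_nonneg (hν0 W) (mul_nonneg (hθ0 W) (hcd0 W))
  have hRB0 : ∀ W, 0 ≤ RB W := fun W => by rw [hRB]; exact mul_nonneg (hν0 W) (hd0 W)
  have hGB0 : ∀ W, 0 ≤ GB W := fun W => by
    rw [hGB]; exact mul_nonneg (hν0 W) (chainMix_dd'_nonneg_gen ent ent' ρ hρ0 hρ1 d d' hd0 hd'0 W)
  have hGBle : ∀ W, GB W ≤ RB W := fun W => by
    rw [hGB, hRB]
    exact mul_le_mul_of_nonneg_left (chainMix_dd'_le_gen ent ent' ρ hρ0 d d' hd'd W) (hν0 W)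
  -- the pointwise decomposition
  have hdecR : ∀ W, ν W * chainMix ent ent' ρ c d W = RA W + RB W := by
    intro W; rw [hRA, hRB]; unfold chainMix; ring
  have hdecG : ∀ W, ν W * chainMix ent ent' ρ c d' W = RA W + GB W := by
    intro W; rw [hRA, hGB]; unfold chainMix; ring
  -- the sums of the goal in terms of the moments of the three laws
  have hs0 : ∑ W ∈ U.powerset, ν W * chainMix ent ent' ρ c d W =
      (∑ W ∈ U.powerset, RA W) + ∑ W ∈ U.powerset, RB W := by
    rw [← Finset.sum_add_distrib]; exact Finset.sum_congr rfl fun W _ => hdecR W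
  have hs1 : ∑ W ∈ U.powerset, ν W * chainMix ent ent' ρ c d W * (if m₁ ∈ W then (1 : R) else 0)
      = (∑ W ∈ U.powerset, RA W * (if m₁ ∈ W then (1 : R) else 0)) +
        ∑ W ∈ U.powerset, RB W * (if m₁ ∈ W then (1 : R) else 0) := by
    rw [← Finset.sum_add_distrib]
    exact Finset.sum_congr rfl fun W _ => by rw [hdecR W]; ring
  have hs2 : ∑ W ∈ U.powerset, ν W * chainMix ent ent' ρ c d W * (if m₂ ∈ W then (1 : R) else 0)
      = (∑ W ∈ U.powerset, RA W * (if m₂ ∈ W then (1 : R) else 0)) +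
        ∑ W ∈ U.powerset, RB W * (if m₂ ∈ W then (1 : R) else 0) := by
    rw [← Finset.sum_add_distrib]
    exact Finset.sum_congr rfl fun W _ => by rw [hdecR W]; ring
  have ht0 : ∑ W ∈ U.powerset, ν W * chainMix ent ent' ρ c d' W =
      (∑ W ∈ U.powerset, RA W) + ∑ W ∈ U.powerset, GB W := by
    rw [← Finset.sum_add_distrib]; exact Finset.sum_congr rfl fun W _ => hdecG W
  have ht1 : ∑ W ∈ U.powerset, ν W * chainMix ent ent' ρ c d' W * (if m₁ ∈ W then (1 : R) else 0)
      = (∑ W ∈ U.powerset, RA W * (if m₁ ∈ W then (1 : R) else 0)) +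
        ∑ W ∈ U.powerset, GB W * (if m₁ ∈ W then (1 : R) else 0) := by
    rw [← Finset.sum_add_distrib]
    exact Finset.sum_congr rfl fun W _ => by rw [hdecG W]; ring
  have ht2 : ∑ W ∈ U.powerset, ν W * chainMix ent ent' ρ c d' W * (if m₂ ∈ W then (1 : R) else 0)
      = (∑ W ∈ U.powerset, RA W * (if m₂ ∈ W then (1 : R) else 0)) +
        ∑ W ∈ U.powerset, GB W * (if m₂ ∈ W then (1 : R) else 0) := by
    rw [← Finset.sum_add_distrib]
    exact Finset.sum_congr rfl fun W _ => by rw [hdecG W]; ring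
  have ht12 : ∑ W ∈ U.powerset, ν W * chainMix ent ent' ρ c d' W *
      ((if m₁ ∈ W then (1 : R) else 0) * (if m₂ ∈ W then (1 : R) else 0))
      = (∑ W ∈ U.powerset, RA W * ((if m₁ ∈ W then (1 : R) else 0) *
          (if m₂ ∈ W then (1 : R) else 0))) +
        ∑ W ∈ U.powerset, GB W * ((if m₁ ∈ W then (1 : R) else 0) *
          (if m₂ ∈ W then (1 : R) else 0)) := by
    rw [← Finset.sum_add_distrib]
    exact Finset.sum_congr rfl fun W _ => by rw [hdecG W]; ring
  rw [hs0, hs1, hs2, ht0, ht1, ht2, ht12]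
  -- log-supermodularity of the three laws
  have hmix := mixture_lsm ent ent' ρ hρ0 hρ1 d d' hd0 hd'0 hd'd hdd hd'd' hdd' hratio''
  have hGBlsm : ∀ s ⊆ U, ∀ t ⊆ U, GB s * GB t ≤ GB (s ∩ t) * GB (s ∪ t) := by
    intro s hs t ht
    rw [hGB, hGB, hGB, hGB]
    calc ν s * chainMix ent ent' ρ d d' s * (ν t * chainMix ent ent' ρ d d' t)
        = (ν s * ν t) * (chainMix ent ent' ρ d d' s * chainMix ent ent' ρ d d' t) := by ring
      _ ≤ (ν (s ∩ t) * ν (s ∪ t)) *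
            (chainMix ent ent' ρ d d' (s ∩ t) * chainMix ent ent' ρ d d' (s ∪ t)) :=
          mul_le_mul (hν s hs t ht) (hmix s t)
            (mul_nonneg (chainMix_dd'_nonneg_gen ent ent' ρ hρ0 hρ1 d d' hd0 hd'0 _)
              (chainMix_dd'_nonneg_gen ent ent' ρ hρ0 hρ1 d d' hd0 hd'0 _))
            (mul_nonneg (hν0 _) (hν0 _))
      _ = _ := by ring
  have hRBlsm : ∀ s ⊆ U, ∀ t ⊆ U, RB s * RB t ≤ RB (s ∩ t) * RB (s ∪ t) := by
    intro s hs t ht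
    rw [hRB, hRB, hRB, hRB]
    calc ν s * d s * (ν t * d t) = (ν s * ν t) * (d s * d t) := by ring
      _ ≤ (ν (s ∩ t) * ν (s ∪ t)) * (d (s ∩ t) * d (s ∪ t)) :=
          mul_le_mul (hν s hs t ht) (hdd s t) (mul_nonneg (hd0 _) (hd0 _))
            (mul_nonneg (hν0 _) (hν0 _))
      _ = _ := by ring
  -- the Holley conditions A ≼ Ā-gate and A ≼ Ā
  have hdomAG : ∀ s ⊆ U, ∀ t ⊆ U, RA s * GB t ≤ RA (s ∩ t) * GB (s ∪ t) := by
    intro s hs t ht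
    rw [hRA, hRA, hGB, hGB]
    have hX := aw_cross_AG_gen ent ent' ρ hρ0 hρ1 c d d' hc0 hd0 hd'0 hdc hd'd hcc hratio hratio' s t
    calc ν s * ((1 - chainTheta ent ent' ρ s) * (c s - d s)) * (ν t * chainMix ent ent' ρ d d' t)
        = (ν s * ν t) *
            ((1 - chainTheta ent ent' ρ s) * (c s - d s) * chainMix ent ent' ρ d d' t) := by ring
      _ ≤ (ν (s ∩ t) * ν (s ∪ t)) *
            ((1 - chainTheta ent ent' ρ (s ∩ t)) * (c (s ∩ t) - d (s ∩ t)) *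
              chainMix ent ent' ρ d d' (s ∪ t)) :=
          mul_le_mul (hν s hs t ht) hX
            (mul_nonneg (mul_nonneg (hθ0 _) (hcd0 _))
              (chainMix_dd'_nonneg_gen ent ent' ρ hρ0 hρ1 d d' hd0 hd'0 _))
            (mul_nonneg (hν0 _) (hν0 _))
      _ = _ := by ring
  have hdomAR : ∀ s ⊆ U, ∀ t ⊆ U, RA s * RB t ≤ RA (s ∩ t) * RB (s ∪ t) := by
    intro s hs t ht
    rw [hRA, hRA, hRB, hRB]
    have hX := aw_cross_AR_gen ent ent' ρ hρ0 hρ1 c d hc0 hd0 hdc hcc hratio s t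
    calc ν s * ((1 - chainTheta ent ent' ρ s) * (c s - d s)) * (ν t * d t)
        = (ν s * ν t) * ((1 - chainTheta ent ent' ρ s) * (c s - d s) * d t) := by ring
      _ ≤ (ν (s ∩ t) * ν (s ∪ t)) *
            ((1 - chainTheta ent ent' ρ (s ∩ t)) * (c (s ∩ t) - d (s ∩ t)) * d (s ∪ t)) :=
          mul_le_mul (hν s hs t ht) hX
            (mul_nonneg (mul_nonneg (hθ0 _) (hcd0 _)) (hd0 _)) (mul_nonneg (hν0 _) (hν0 _))
      _ = _ := by ring
  -- the Ā-pair (linearity in the gate + `chain_world1_nonneg` twice)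
  have hT11 := abar_pair_nonneg_gen U ent ent' ν d d' ρ hρ0 hρ1 hν0 hν hd0 hd'0 hd'd hdd hd'd'
    hdd' hratio'' m₁ m₂
  have eRB : ∀ f : Finset V → R, ∑ W ∈ U.powerset, RB W * f W = ∑ W ∈ U.powerset, ν W * d W * f W :=
    fun f => Finset.sum_congr rfl fun W _ => by rw [hRB]
  have eRB0 : ∑ W ∈ U.powerset, RB W = ∑ W ∈ U.powerset, ν W * d W :=
    Finset.sum_congr rfl fun W _ => by rw [hRB]
  have eGB : ∀ f : Finset V → R, ∑ W ∈ U.powerset, GB W * f W =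
      ∑ W ∈ U.powerset, ν W * chainMix ent ent' ρ d d' W * f W :=
    fun f => Finset.sum_congr rfl fun W _ => by rw [hGB]
  have eGB0 : ∑ W ∈ U.powerset, GB W = ∑ W ∈ U.powerset, ν W * chainMix ent ent' ρ d d' W :=
    Finset.sum_congr rfl fun W _ => by rw [hGB]
  rw [← eRB0, ← eGB0, ← eRB (fun W => if m₁ ∈ W then (1 : R) else 0),
    ← eRB (fun W => if m₂ ∈ W then (1 : R) else 0), ← eGB (fun W => if m₁ ∈ W then (1 : R) else 0),
    ← eGB (fun W => if m₂ ∈ W then (1 : R) else 0),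
    ← eGB (fun W => (if m₁ ∈ W then (1 : R) else 0) * (if m₂ ∈ W then (1 : R) else 0))] at hT11
  -- the four ingredients of (★)
  have hD' : (∑ W ∈ U.powerset, RA W * (if m₁ ∈ W then (1 : R) else 0)) *
      (∑ W ∈ U.powerset, RA W * (if m₂ ∈ W then (1 : R) else 0)) ≤
      (∑ W ∈ U.powerset, RA W) * (∑ W ∈ U.powerset, RA W *
        ((if m₁ ∈ W then (1 : R) else 0) * (if m₂ ∈ W then (1 : R) else 0))) := by
    have e : ∀ W, RA W = ν W * ((1 - chainTheta ent ent' ρ W) * (c W - d W)) := hRA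
    simp only [e]; exact hD
  have hFG := aw_fkg_sums U GB (fun W => if m₁ ∈ W then (1 : R) else 0)
    (fun W => if m₂ ∈ W then (1 : R) else 0) hGB0 hx0 hy0 hxm hym hGBlsm
  have hH1 := aw_holley_sums U RA GB (fun W => if m₁ ∈ W then (1 : R) else 0) hRA0 hGB0 hx0 hxm
    hdomAG
  have hH2 := aw_holley_sums U RA GB (fun W => if m₂ ∈ W then (1 : R) else 0) hRA0 hGB0 hy0 hym
    hdomAG
  have hK1 := aw_holley_sums U RA RB (fun W => if m₁ ∈ W then (1 : R) else 0) hRA0 hRB0 hx0 hxm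
    hdomAR
  have hK2 := aw_holley_sums U RA RB (fun W => if m₂ ∈ W then (1 : R) else 0) hRA0 hRB0 hy0 hym
    hdomAR
  -- bounds of the moments
  have bnd : ∀ (F : Finset V → R), (∀ W, 0 ≤ F W) →
      0 ≤ ∑ W ∈ U.powerset, F W ∧
      0 ≤ ∑ W ∈ U.powerset, F W * (if m₁ ∈ W then (1 : R) else 0) ∧
      0 ≤ ∑ W ∈ U.powerset, F W * (if m₂ ∈ W then (1 : R) else 0) ∧
      0 ≤ ∑ W ∈ U.powerset, F W * ((if m₁ ∈ W then (1 : R) else 0) *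
        (if m₂ ∈ W then (1 : R) else 0)) ∧
      (∑ W ∈ U.powerset, F W * (if m₁ ∈ W then (1 : R) else 0)) ≤ ∑ W ∈ U.powerset, F W ∧
      (∑ W ∈ U.powerset, F W * (if m₂ ∈ W then (1 : R) else 0)) ≤ ∑ W ∈ U.powerset, F W ∧
      (∑ W ∈ U.powerset, F W * ((if m₁ ∈ W then (1 : R) else 0) *
        (if m₂ ∈ W then (1 : R) else 0))) ≤ ∑ W ∈ U.powerset, F W := by
    intro F hF
    refine ⟨Finset.sum_nonneg fun W _ => hF W,
      Finset.sum_nonneg fun W _ => mul_nonneg (hF W) (hx0 W),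
      Finset.sum_nonneg fun W _ => mul_nonneg (hF W) (hy0 W),
      Finset.sum_nonneg fun W _ => mul_nonneg (hF W) (mul_nonneg (hx0 W) (hy0 W)),
      Finset.sum_le_sum fun W _ => mul_le_of_le_one_right (hF W) (hx1 W),
      Finset.sum_le_sum fun W _ => mul_le_of_le_one_right (hF W) (hy1 W),
      Finset.sum_le_sum fun W _ =>
        mul_le_of_le_one_right (hF W) (mul_le_one₀ (hx1 W) (hy0 W) (hy1 W))⟩
  obtain ⟨ha0, ha1, ha2, ha12, ha1le, ha2le, ha12le⟩ := bnd RA hRA0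
  obtain ⟨hb0, hb1, hb2, -, hb1le, hb2le, -⟩ := bnd RB hRB0
  obtain ⟨hg0, hg1, hg2, hg12, hg1le, hg2le, hg12le⟩ := bnd GB hGB0
  have hgb : ∑ W ∈ U.powerset, GB W ≤ ∑ W ∈ U.powerset, RB W :=
    Finset.sum_le_sum fun W _ => hGBle W
  exact aw_assemble _ _ _ _ _ _ _ _ _ _ _ ha0 ha1 ha2 ha12 ha1le ha2le ha12le hb0 hb1 hb2 hb1le
    hb2le hg0 hg1 hg2 hg12 hg1le hg2le hg12le hgb (by linarith [hD'])
    (aw_T01_nonneg _ _ _ _ _ _ _ hg0 hg1 hg2 hg12 hg1le hg2le hg12le hFG hH1 hH2) hT11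
    (mul_nonneg_of_nonpos_of_nonpos (by linarith [hK1]) (by linarith [hK2]))


/-- **THE GENERAL CHAIN WITH `c − d` LOG-SUPERMODULAR**: the structural form — `hcd_lsm` gives
the A-law covariance hypothesis by FKG. -/
theorem chain_functional_nonneg_of_diffLsm (U ent ent' : Finset V) (ν c d d' : Finset V → R)
    (ρ : R) (hρ0 : 0 ≤ ρ) (hρ1 : ρ ≤ 1) (hν0 : ∀ W, 0 ≤ ν W)
    (hν : ∀ s ⊆ U, ∀ t ⊆ U, ν s * ν t ≤ ν (s ∩ t) * ν (s ∪ t))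
    (hc0 : ∀ W, 0 ≤ c W) (hd0 : ∀ W, 0 ≤ d W) (hd'0 : ∀ W, 0 ≤ d' W)
    (hdc : ∀ W, d W ≤ c W) (hd'd : ∀ W, d' W ≤ d W)
    (hcc : ∀ s t, c s * c t ≤ c (s ∩ t) * c (s ∪ t))
    (hdd : ∀ s t, d s * d t ≤ d (s ∩ t) * d (s ∪ t))
    (hd'd' : ∀ s t, d' s * d' t ≤ d' (s ∩ t) * d' (s ∪ t))
    (hdd' : ∀ s t, d s * d' t ≤ d (s ∩ t) * d' (s ∪ t))
    (hratio : ∀ s t, s ⊆ t → d s * c t ≤ c s * d t)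
    (hratio' : ∀ s t, s ⊆ t → d' s * c t ≤ c s * d' t)
    (hratio'' : ∀ s t, s ⊆ t → d' s * d t ≤ d s * d' t)
    (hcd_lsm : ∀ s t, (c s - d s) * (c t - d t) ≤
      (c (s ∩ t) - d (s ∩ t)) * (c (s ∪ t) - d (s ∪ t))) (m₁ m₂ : V) :
    0 ≤ (∑ W ∈ U.powerset, ν W * chainMix ent ent' ρ c d W) ^ 2 *
          (∑ W ∈ U.powerset, ν W * chainMix ent ent' ρ c d' W *
            ((if m₁ ∈ W then (1 : R) else 0) * (if m₂ ∈ W then (1 : R) else 0)))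
        - (∑ W ∈ U.powerset, ν W * chainMix ent ent' ρ c d W) *
          (∑ W ∈ U.powerset, ν W * chainMix ent ent' ρ c d W * (if m₁ ∈ W then (1 : R) else 0)) *
          (∑ W ∈ U.powerset, ν W * chainMix ent ent' ρ c d' W * (if m₂ ∈ W then (1 : R) else 0))
        - (∑ W ∈ U.powerset, ν W * chainMix ent ent' ρ c d W) *
          (∑ W ∈ U.powerset, ν W * chainMix ent ent' ρ c d W * (if m₂ ∈ W then (1 : R) else 0)) *
          (∑ W ∈ U.powerset, ν W * chainMix ent ent' ρ c d' W * (if m₁ ∈ W then (1 : R) else 0))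
        + (∑ W ∈ U.powerset, ν W * chainMix ent ent' ρ c d W * (if m₁ ∈ W then (1 : R) else 0)) *
          (∑ W ∈ U.powerset, ν W * chainMix ent ent' ρ c d W * (if m₂ ∈ W then (1 : R) else 0)) *
          (∑ W ∈ U.powerset, ν W * chainMix ent ent' ρ c d' W) := by
  obtain ⟨hθ0, -, hθlsm⟩ := one_sub_theta_facts_gen ent ent' ρ hρ0 hρ1
  have hcd0 : ∀ W, 0 ≤ c W - d W := fun W => by linarith [hdc W]
  have hx0 : ∀ W : Finset V, (0 : R) ≤ (if m₁ ∈ W then (1 : R) else 0) := by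
    intro W; split_ifs <;> norm_num
  have hy0 : ∀ W : Finset V, (0 : R) ≤ (if m₂ ∈ W then (1 : R) else 0) := by
    intro W; split_ifs <;> norm_num
  have hxm : ∀ s t : Finset V,
      (if m₁ ∈ s then (1 : R) else 0) ≤ (if m₁ ∈ s ∪ t then (1 : R) else 0) := by
    intro s t
    by_cases h : m₁ ∈ s
    · rw [if_pos h, if_pos (Finset.mem_union_left t h)]
    · rw [if_neg h]; split_ifs <;> norm_num
  have hym : ∀ s t : Finset V,
      (if m₂ ∈ s then (1 : R) else 0) ≤ (if m₂ ∈ s ∪ t then (1 : R) else 0) := by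
    intro s t
    by_cases h : m₂ ∈ s
    · rw [if_pos h, if_pos (Finset.mem_union_left t h)]
    · rw [if_neg h]; split_ifs <;> norm_num
  have hRAlsm : ∀ s ⊆ U, ∀ t ⊆ U,
      ν s * ((1 - chainTheta ent ent' ρ s) * (c s - d s)) *
        (ν t * ((1 - chainTheta ent ent' ρ t) * (c t - d t))) ≤
      ν (s ∩ t) * ((1 - chainTheta ent ent' ρ (s ∩ t)) * (c (s ∩ t) - d (s ∩ t))) *
        (ν (s ∪ t) * ((1 - chainTheta ent ent' ρ (s ∪ t)) * (c (s ∪ t) - d (s ∪ t)))) := by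
    intro s hs t ht
    calc ν s * ((1 - chainTheta ent ent' ρ s) * (c s - d s)) *
          (ν t * ((1 - chainTheta ent ent' ρ t) * (c t - d t)))
        = (ν s * ν t) * (((1 - chainTheta ent ent' ρ s) * (1 - chainTheta ent ent' ρ t)) *
            ((c s - d s) * (c t - d t))) := by ring
      _ ≤ (ν (s ∩ t) * ν (s ∪ t)) *
            (((1 - chainTheta ent ent' ρ (s ∩ t)) * (1 - chainTheta ent ent' ρ (s ∪ t))) *
            ((c (s ∩ t) - d (s ∩ t)) * (c (s ∪ t) - d (s ∪ t)))) := by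
          apply mul_le_mul (hν s hs t ht) (mul_le_mul (hθlsm s t) (hcd_lsm s t)
            (mul_nonneg (hcd0 _) (hcd0 _)) (mul_nonneg (hθ0 _) (hθ0 _)))
          · exact mul_nonneg (mul_nonneg (hθ0 _) (hθ0 _)) (mul_nonneg (hcd0 _) (hcd0 _))
          · exact mul_nonneg (hν0 _) (hν0 _)
      _ = _ := by ring
  have hD := aw_fkg_sums U (fun W => ν W * ((1 - chainTheta ent ent' ρ W) * (c W - d W)))
    (fun W => if m₁ ∈ W then (1 : R) else 0) (fun W => if m₂ ∈ W then (1 : R) else 0)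
    (fun W => mul_nonneg (hν0 W) (mul_nonneg (hθ0 W) (hcd0 W))) hx0 hy0 hxm hym hRAlsm
  exact chain_functional_nonneg_of_covA U ent ent' ν c d d' ρ hρ0 hρ1 hν0 hν hc0 hd0 hd'0 hdc hd'd
    hcc hdd hd'd' hdd' hratio hratio' hratio'' m₁ m₂ hD

end ChainAWorldGen

end Summit.Ventures.PercRepro2.Coin
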